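import Summits.QuantumFields.GaugeBoot.DiagonalRPTorusRingCollapse
import HarnessLib

/-!
# The value of the tube: `c₁⁹ N` (gauge-boot, L3 sequel, 11/12)

HONEST FRAMING (cell `pub-gaugeboot`, page 1 of every file): the venture produces certified bounds
on lattice expectations at stated coupling, gauge group, dimension and torus size; NOT a mass gap,
NOT a continuum limit, NOT a string tension; NOT Yang–Mills-summit-bearing (barriers
`FixedCouplingUltralocality`, `PerturbativeInvisibility`). This module is bookkeeping for a
structural NEGATIVE result (`DiagonalRPTorusInnerHalfNegativeHighDim`); it discharges nothing by
itself.

## Content (torus `(ℤ/L)^d`, `L ≥ 3`, directions `m < k < l`, compact metrisable `G`,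
continuous `ρ` with (R1) `∫ Re χ(x g⁻¹) Re χ(g y) dg = c₁ Re χ(x y)`)

* `plaqRe_sq_update_of_ne`, `plaqRe_ring_update_of_ne` — a transverse square / a ring face does
  not read links based at other `m`-heights;
* `integral_plaqRe_sq_mul_self` — `∫ Re χ(U_q) Re χ(U_q) = c₁ N` for a transverse square `q`;
* ★ **`tube_integral_eq`** — the TUBE VALUE: for the two squares `sq y`, `sq (y + 2e_m)` and the
  eight ring faces between them,
  `∫ Re χ(U_{sq (y+2e_m)}) Re χ(U_{sq y}) (∏ₐ Re χ(U_{ring m y a})) (∏ₐ Re χ(U_{ring m (y+e_m) a}))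
   = c₁⁹ N` (two ring collapses and the square integral).

Folklore strong-coupling integration; no definition of record, no named fact.
-/

open MeasureTheory Finset Function

namespace Summit.QuantumFields.GaugeBoot

open Literature.MathematicalPhysics.QuantumFieldTheory
open Literature.MathematicalPhysics.QuantumFieldTheory.PlaquetteLowerBound (reTr)
open Summit.Ventures.YMGap.RobustBall (one_ne_zero_of_three_le two_ne_zero_of_three_le)

noncomputable section

namespace DiagRPTube

variable {d L : ℕ} [NeZero L] {N : ℕ} {G : Type*} [Group G] [TopologicalSpace G]
  [IsTopologicalGroup G] [CompactSpace G] [MeasurableSpace G] [BorelSpace G]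
  [SecondCountableTopology G] (ρ : G →* Matrix (Fin N) (Fin N) ℂ)
  {m k l : Fin d} (hmk : m < k) (hml : m < l) (hkl : k < l)

/-! ## Squares and ring faces do not read other `m`-heights -/

section Heights

omit [NeZero L] [TopologicalSpace G] [IsTopologicalGroup G] [CompactSpace G] [MeasurableSpace G]
  [BorelSpace G] [SecondCountableTopology G]

include hmk hml in
/-- The `m`-coordinate of the start point of an edge of `sq w` is `w m`. -/
theorem eStart_apply_m (w : Site d L) (a : Fin 4) : eStart k l w a m = w m := by
  have hmk' : m ≠ k := ne_of_lt hmk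
  have hml' : m ≠ l := ne_of_lt hml
  fin_cases a <;> simp [eStart, Site.shift, Pi.single_eq_of_ne hmk', Pi.single_eq_of_ne hml']

include hmk hml in
/-- **A transverse square does not read links based at another `m`-height.** -/
theorem plaqRe_sq_update_of_ne {w : Site d L} {e : Edge d L} (he : e.1 m ≠ w m)
    (U : GaugeConfig d L G) (s : G) :
    WilsonRP.plaqRe ρ (update U e s) (sq k l hkl w) = WilsonRP.plaqRe ρ U (sq k l hkl w) := by
  refine plaqRe_update_of_not_hasLink ρ _ (fun ⟨a, ha⟩ => he ?_) U s
  rw [← ha, link_sq]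
  exact eStart_apply_m hmk hml w a

include hmk hml hkl in
/-- **A ring face does not read links based at `m`-heights other than `w m`, `w m + 1`.** -/
theorem plaqRe_ring_update_of_ne {w : Site d L} (a : Fin 4) {e : Edge d L} (he : e.1 m ≠ w m)
    (he' : e.1 m ≠ w m + 1) (U : GaugeConfig d L G) (s : G) :
    WilsonRP.plaqRe ρ (update U e s) (ring hmk hml w a) = WilsonRP.plaqRe ρ U (ring hmk hml w a) := by
  refine plaqRe_update_of_not_hasLink ρ _ (fun h => ?_) U s
  rcases (hasLink_ring_iff hmk hml hkl w a e).1 h with h' | h' | h' | h'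
  · exact he (by rw [h']; exact eStart_apply_m hmk hml w a)
  · exact he' (by rw [h', link_sq, eStart_shift]; simp [Site.shift, eStart_apply_m hmk hml w a])
  · apply he
    rw [h']
    show (eEnd k l w a) m = w m
    unfold eEnd
    rcases eDir_eq_or (k := k) (l := l) a with hd | hd <;> rw [hd]
    · rw [WilsonRP.shift_apply_of_ne _ (ne_of_lt hmk), eStart_apply_m hmk hml]
    · rw [WilsonRP.shift_apply_of_ne _ (ne_of_lt hml), eStart_apply_m hmk hml]
  · exact he (by rw [h', link_sq]; exact eStart_apply_m hmk hml w a)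

end Heights

/-! ## The square integral and the tube value -/

section Value

variable (hL : 3 ≤ L) (hρ : Continuous ρ) {c₁ : ℝ}
  (hR1 : ∀ x y : G, ∫ g, reTr ρ (x * g⁻¹) * reTr ρ (g * y) ∂haarProbability G = c₁ * reTr ρ (x * y))

include hkl hL hρ hR1 in
set_option linter.unusedSimpArgs false in
/-- **`∫ Re χ(U_q)² = c₁ N`** for a transverse square `q = sq w`. -/
theorem integral_plaqRe_sq_mul_self (w : Site d L) :
    ∫ U, WilsonRP.plaqRe ρ U (sq k l hkl w) * WilsonRP.plaqRe ρ U (sq k l hkl w)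
        ∂Measure.pi (fun _ : Edge d L => haarProbability G) = c₁ * N := by
  have hkl' : k ≠ l := ne_of_lt hkl
  have hlk : l ≠ k := hkl'.symm
  have s01 : w.shift k ≠ w := shift_ne hL w k
  have s02 : w.shift l ≠ w := shift_ne hL w l
  have hinv : ∀ g : G, reTr ρ g⁻¹ = reTr ρ g := fun g =>
    Literature.RepresentationTheory.CompactGroups.CompactGroup.re_trace_map_inv ρ hρ g
  have hS : ∀ U : GaugeConfig d L G, WilsonRP.plaqRe ρ U (sq k l hkl w) =
      reTr ρ (U (w, k) * U (w.shift k, l) * (U (w.shift l, k))⁻¹ * (U (w, l))⁻¹) := fun U => rfl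
  have hSa : ∀ U : GaugeConfig d L G, WilsonRP.plaqRe ρ U (sq k l hkl w) =
      reTr ρ (1 * U (w, k) * (U (w.shift k, l) * (U (w.shift l, k))⁻¹ * (U (w, l))⁻¹)) := fun U => by
    rw [hS]; exact congrArg _ (by group)
  have hSb : ∀ U : GaugeConfig d L G, WilsonRP.plaqRe ρ U (sq k l hkl w) =
      reTr ρ ((U (w.shift k, l) * (U (w.shift l, k))⁻¹ * (U (w, l))⁻¹)⁻¹ * (U (w, k))⁻¹ * 1) := fun U => by
    rw [hS, ← hinv]; exact congrArg _ (by group)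
  have hint : Integrable (fun U : GaugeConfig d L G =>
      WilsonRP.plaqRe ρ U (sq k l hkl w) * WilsonRP.plaqRe ρ U (sq k l hkl w))
      (Measure.pi fun _ : Edge d L => haarProbability G) :=
    integrable_of_continuous ((continuous_plaqRe ρ hρ _).mul (continuous_plaqRe ρ hρ _))
  have h := glue ρ hR1 (w, k) hint (fun _ => 1)
    (fun U => (U (w.shift k, l) * (U (w.shift l, k))⁻¹ * (U (w, l))⁻¹)⁻¹) (fun _ => 1)
    (fun _ => 1) (fun U => U (w.shift k, l) * (U (w.shift l, k))⁻¹ * (U (w, l))⁻¹) (fun U s => by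
      show WilsonRP.plaqRe ρ (update U (w, k) s) (sq k l hkl w) *
          WilsonRP.plaqRe ρ (update U (w, k) s) (sq k l hkl w) = _
      nth_rewrite 1 [hSb (update U (w, k) s)]
      rw [hSa (update U (w, k) s)]
      simp only [update_apply, Prod.mk.injEq, hkl', hlk, s01, s02, true_and, and_true, and_false,
        if_true, if_false]
      ring)
  rw [h]
  have hone : ∀ U : GaugeConfig d L G, (1 : ℝ) * reTr ρ (1 *
      (U (w.shift k, l) * (U (w.shift l, k))⁻¹ * (U (w, l))⁻¹)⁻¹ *
      (U (w.shift k, l) * (U (w.shift l, k))⁻¹ * (U (w, l))⁻¹ * 1)) = N := fun U => by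
    rw [one_mul, one_mul, mul_one, inv_mul_cancel]
    simp [reTr, Matrix.trace_one]
  simp_rw [hone]
  rw [integral_const, probReal_univ, one_smul]

include hmk hml hkl hL hρ hR1 in
set_option linter.unusedSimpArgs false in
/-- ★ **THE TUBE VALUE**: the product-Haar integral of the two squares `sq (y + 2e_m)`, `sq y` and
the eight ring faces between them is `c₁⁹ N`. -/
theorem tube_integral_eq (y : Site d L) :
    ∫ U, WilsonRP.plaqRe ρ U (sq k l hkl ((y.shift m).shift m)) * WilsonRP.plaqRe ρ U (sq k l hkl y) *
        ((∏ a : Fin 4, WilsonRP.plaqRe ρ U (ring hmk hml y a)) *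
          ∏ a : Fin 4, WilsonRP.plaqRe ρ U (ring hmk hml (y.shift m) a))
        ∂Measure.pi (fun _ : Edge d L => haarProbability G) = c₁ ^ 9 * N := by
  have hmk' : m ≠ k := ne_of_lt hmk
  have hml' : m ≠ l := ne_of_lt hml
  have h1 : (1 : ZMod L) ≠ 0 := one_ne_zero_of_three_le hL
  have h2 : (2 : ZMod L) ≠ 0 := two_ne_zero_of_three_le hL
  have hm1 : (y.shift m) m = y m + 1 := WilsonRP.shift_apply_self y m
  have hm2 : ((y.shift m).shift m) m = y m + 1 + 1 := by
    rw [WilsonRP.shift_apply_self, hm1]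
  -- first collapse, with `H = Re χ(U_{sq (y+2e_m)}) ∏ₐ Re χ(U_{ring (y+e_m) a})`
  have hH1 : Continuous fun U : GaugeConfig d L G =>
      WilsonRP.plaqRe ρ U (sq k l hkl ((y.shift m).shift m)) *
        ∏ a : Fin 4, WilsonRP.plaqRe ρ U (ring hmk hml (y.shift m) a) :=
    (continuous_plaqRe ρ hρ _).mul (continuous_finsetProd _ fun a _ => continuous_plaqRe ρ hρ _)
  have hH1m : ∀ e : Edge d L, e.1 m = y m → ∀ (U : GaugeConfig d L G) (s : G),
      WilsonRP.plaqRe ρ (update U e s) (sq k l hkl ((y.shift m).shift m)) *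
          ∏ a : Fin 4, WilsonRP.plaqRe ρ (update U e s) (ring hmk hml (y.shift m) a) =
        WilsonRP.plaqRe ρ U (sq k l hkl ((y.shift m).shift m)) *
          ∏ a : Fin 4, WilsonRP.plaqRe ρ U (ring hmk hml (y.shift m) a) := by
    intro e he U s
    rw [plaqRe_sq_update_of_ne ρ hmk hml hkl (by rw [he, hm2]; intro h; apply h2; linear_combination -h)]
    congr 1
    refine prod_congr rfl fun a _ => plaqRe_ring_update_of_ne ρ hmk hml hkl a ?_ ?_ U s
    · rw [he, hm1]; intro h; apply h1; linear_combination -h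
    · rw [he, hm1]; intro h; apply h2; linear_combination -h
  have step1 := ring_collapse ρ hmk hml hkl hL hρ hR1 y hH1 hH1m
  -- second collapse, with `H = Re χ(U_{sq (y+2e_m)})`
  have hH2 : Continuous fun U : GaugeConfig d L G =>
      WilsonRP.plaqRe ρ U (sq k l hkl ((y.shift m).shift m)) := continuous_plaqRe ρ hρ _
  have hH2m : ∀ e : Edge d L, e.1 m = (y.shift m) m → ∀ (U : GaugeConfig d L G) (s : G),
      WilsonRP.plaqRe ρ (update U e s) (sq k l hkl ((y.shift m).shift m)) =
        WilsonRP.plaqRe ρ U (sq k l hkl ((y.shift m).shift m)) := fun e he U s =>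
    plaqRe_sq_update_of_ne ρ hmk hml hkl (by rw [he, hm1, hm2]; intro h; apply h1; linear_combination -h) U s
  have step2 := ring_collapse ρ hmk hml hkl hL hρ hR1 (y.shift m) hH2 hH2m
  have step3 := integral_plaqRe_sq_mul_self ρ hkl hL hρ hR1 ((y.shift m).shift m)
  -- assemble
  have e1 : ∀ U : GaugeConfig d L G,
      WilsonRP.plaqRe ρ U (sq k l hkl ((y.shift m).shift m)) * WilsonRP.plaqRe ρ U (sq k l hkl y) *
        ((∏ a : Fin 4, WilsonRP.plaqRe ρ U (ring hmk hml y a)) *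
          ∏ a : Fin 4, WilsonRP.plaqRe ρ U (ring hmk hml (y.shift m) a)) =
      (WilsonRP.plaqRe ρ U (sq k l hkl ((y.shift m).shift m)) *
        ∏ a : Fin 4, WilsonRP.plaqRe ρ U (ring hmk hml (y.shift m) a)) *
        WilsonRP.plaqRe ρ U (sq k l hkl y) * ∏ a : Fin 4, WilsonRP.plaqRe ρ U (ring hmk hml y a) :=
    fun U => by ring
  have e2 : ∀ U : GaugeConfig d L G,
      (WilsonRP.plaqRe ρ U (sq k l hkl ((y.shift m).shift m)) *
        ∏ a : Fin 4, WilsonRP.plaqRe ρ U (ring hmk hml (y.shift m) a)) *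
        WilsonRP.plaqRe ρ U (sq k l hkl (y.shift m)) =
      WilsonRP.plaqRe ρ U (sq k l hkl ((y.shift m).shift m)) * WilsonRP.plaqRe ρ U (sq k l hkl (y.shift m)) *
        ∏ a : Fin 4, WilsonRP.plaqRe ρ U (ring hmk hml (y.shift m) a) := fun U => by ring
  simp_rw [e1]
  rw [step1]
  simp_rw [e2]
  rw [step2, step3]
  ring

end Value

end DiagRPTube

end

end Summit.QuantumFields.GaugeBoot
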